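import Summits.HodgeConjecture.CorCM.MumfordTateRankAtMostThree
import Summits.HodgeConjecture.CorCM.CMEllipticCurveTimesSimpleCMThreefold
import Summits.HodgeConjecture.CorCM.CMCurvesAndSimpleSurfacesHodge
import Literature.AlgebraicGeometry.Pohlmann1968.SimpleCMAbelianFourfoldPowers
import HarnessLib

/-!
# The Mumford–Tate rank `4`, CM side: a complex abelian variety of CM type with `dim MT(H¹(X)) = 4` has reduced
# dimension `3` (stably nondegenerate) or `4`, and then EXACTLY two shapes — powers of a simple CM fourfold of Weil
# type, or `E^c × T^a` with the CM field of the curve `E` inside the sextic CM field of the simple threefold `T`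

COR-CM (cell `pub-hodgecm2`, seat `b27` gen 32, count-neutral lane MT-RANK-FOUR-CM, file 1; theorems only, no definition,
no named fact; UNCONDITIONAL).  NEW as stated (an assembly of tree theorems), hence under `Summits/`.  Sequel of
`CorCM/MumfordTateRankAtMostThree` (gen 28: `dim MT(H¹(X)) ≤ 3` ⟹ all powers divisor-generated) and of the non-CM half of
the rung `dim MT(H¹(X)) = 4` (`CorCM/MumfordTateRankFour`, `CorCM/MumfordTateRankFourDivisorClasses`, gens 30–31: `X` not
of CM type with `dim MT(H¹(X)) ≤ 4` is stably nondegenerate).  HONEST FRAMING: an unconditional structure theorem on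
Mumford–Tate groups of CM abelian varieties; `HC_CM` is neither used nor asserted.

For `X` a complex abelian variety of CM type (`Milne1999.IsOfCMType`, `0 < dim X`) write `t = dim MT(H¹(X))`
(`(BettiUniverse.hodge … hX 1).mtRank`) and let `X ∼ ⨁_j A'_{cls j}` be Milne's regrouping into copies of SIMPLE, PAIRWISE
NON-ISOGENOUS CM realisations `(A'_c, ι_c, θ_c) ⊨ (K_c; Φ_c)` (`exists_isIsogeny_biproduct_of_isSimple_of_isOfCMType`), with
reduced dimension `rdim X = Σ_c dim A'_c`.  The tree knows `t ≤ rdim X + 1` with equality iff all powers of `X` are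
divisor-generated (Hazama–Murty, gen 27 `exists_rdim_of_isOfCMType`) and Ribet's bound `4 · rdim X ≤ 2^t` (gen 28).  At
`t = 4` this leaves `rdim X ∈ {3, 4}`:

* `sum_dim_eq_three_or_four_of_mtRank_hodge_one_eq_four` — `rdim X = 3` or `4`, and `rdim X = 3` iff every power
  `X^{N+1}` is divisor-generated (`B• = D•`; then the Hodge conjecture holds on all of them, gen 27).
* **`shape_of_not_isNondegenerateFamily_of_sum_dim_eq_four`** (family level) — a DEGENERATE separating family of simple
  CM realisations of total dimension `4` is either ONE simple CM fourfold, or ONE simple CM threefold `T` and ONE CM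
  elliptic curve `E` whose imaginary quadratic field EMBEDS in the sextic field of `T`.  The other dimension patterns are
  nondegenerate BY NAME: `{2,2}`, `{2,1,1}`, `{1,1,1,1}` by p2's `CMCurvesAndSurfaces.isNondegenerateFamily_curves_simpleSurfaces_of_closures`
  (no three of at most two quartic and some pairwise non-isomorphic quadratic fields share a Galois closure), and the
  pattern `{3,1}` is decided by b16's `isNondegenerateFamily_iff_isEmpty_of_quadratic_slot` (Moonen–Zarhin (0.2):
  degenerate iff `k ↪ K`).
* **`shape_of_mtRank_hodge_one_eq_four_of_not_forall_isDivisorGenerated`** (on the variety) — for `X` of CM type with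
  `t = 4` and SOME power not divisor-generated: EITHER `X ∼ ⨁_{Fin (m+1)} A` with `A` a SIMPLE CM abelian FOURFOLD with
  `dim MT(H¹(A)) = 4` and `B(A) ≠ D(A)` (Weil type, Gordon 5.13 (ii); `Pohlmann1968/SimpleCMAbelianFourfoldPowers`), OR
  `X ∼ ⨁_j ![E, T] (κ j)` (`κ` onto `Fin 2`) with `T ⊨ (K; Φ)` a SIMPLE CM threefold (`[K:ℚ] = 6`), `E ⊨ (k; Ψ)` a CM
  elliptic curve (`[k:ℚ] = 2`) and a ring map `i : k →+* K` (Moonen–Zarhin 1999 Thm. (0.2) (a)).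
The converses (both shapes do have `t = 4` and a power with an exceptional class: the classification is sharp) are the
sequel `CorCM/MumfordTateRankFourCMConverse`; the Hodge-conjecture consequences (every complex abelian variety with
`dim MT(H¹(X)) ≤ 4` satisfies the Hodge conjecture with all its powers, given only Markman's fourfold theorem,
unconditionally outside the two shapes) are drawn in `CorCM/MumfordTateRankLeFourHodge`.

## References

* [MoonenZarhin1999LowDim] B. Moonen, Yu. Zarhin, *Hodge classes on abelian varieties of low dimension*, Math. Ann.
  315 (1999) 711–733, Thm. (0.1), Thm. (0.2) (a)/(4), §3 (3.1), Cor. (3.9).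
* [Gordon1999HodgeAVSurvey] B. B. Gordon, *A survey of the Hodge conjecture for abelian varieties* (arXiv:alg-geom/9709030),
  5.13 (i)–(ii), 7.4–7.7, 9.1, 9.4.
* [Dodson1987] B. Dodson, *On the Mumford–Tate group of an abelian variety with complex multiplication*, J. Algebra 111
  (1987), Thm. 1.0 (iii).
* [Ribet1980] K. A. Ribet, Mém. SMF (2) 2 (1980), §3 (3.5), (3.7).
* [Milne1999LefschetzClasses] J. S. Milne, *Lefschetz classes on abelian varieties*, Duke Math. J. 96 (1999), §1 Prop. 1.1.
-/

noncomputable section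

open CategoryTheory CategoryTheory.Limits NumberField Module
open scoped BigOperators

namespace Summit.HodgeConjecture.CorCM

open Literature.NumberTheory.ComplexMultiplication
open Literature.AlgebraicGeometry.Motives
open Literature.AlgebraicGeometry.Motives.AbelianVariety
open Literature.AlgebraicGeometry.HodgeTheory
open Literature.AlgebraicGeometry.ComplexMultiplication (IsCMTypeRealisation)
open Literature.AlgebraicGeometry.Milne1999 (IsOfCMType)
open Literature.AlgebraicGeometry.Pohlmann1968

/-! ## §1 Bookkeeping: positive integers summing to `4` -/

section Arith

variable {C : Type} [Fintype C] [DecidableEq C] {d : C → ℕ}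

/-- If positive integers indexed by `C` sum to `4` and one of them is `4`, it is the only one. [folklore] -/
private theorem forall_eq_of_sum_eq_four_of_eq_four (hpos : ∀ c, 1 ≤ d c) (hsum : ∑ c, d c = 4) {c₀ : C}
    (h4 : d c₀ = 4) (c : C) : c = c₀ := by
  by_contra hc
  have h := Finset.add_sum_erase Finset.univ d (Finset.mem_univ c₀)
  have hle : d c ≤ ∑ x ∈ Finset.univ.erase c₀, d x :=
    Finset.single_le_sum (f := d) (fun _ _ => Nat.zero_le _) (Finset.mem_erase.2 ⟨hc, Finset.mem_univ c⟩)
  have h1 := hpos c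
  omega

/-- If positive integers indexed by `C` sum to `4` and one of them is `3`, there is exactly one other index, carrying
the value `1`. [folklore] -/
private theorem exists_eq_one_of_sum_eq_four_of_eq_three (hpos : ∀ c, 1 ≤ d c) (hsum : ∑ c, d c = 4) {c₀ : C}
    (h3 : d c₀ = 3) : ∃ c₁, c₁ ≠ c₀ ∧ d c₁ = 1 ∧ ∀ c, c = c₀ ∨ c = c₁ := by
  have h := Finset.add_sum_erase Finset.univ d (Finset.mem_univ c₀)
  have hrest : ∑ x ∈ Finset.univ.erase c₀, d x = 1 := by omega
  -- the rest is nonempty (its sum is `1`) …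
  obtain ⟨c₁, hc₁⟩ : (Finset.univ.erase c₀).Nonempty := by
    by_contra hne
    rw [Finset.not_nonempty_iff_eq_empty] at hne
    rw [hne, Finset.sum_empty] at hrest
    exact zero_ne_one hrest
  have hc₁ne : c₁ ≠ c₀ := (Finset.mem_erase.1 hc₁).1
  -- … and every member of the rest carries at least `1`, so it is `{c₁}` with `d c₁ = 1`
  have h' := Finset.add_sum_erase (Finset.univ.erase c₀) d hc₁
  have hle1 : d c₁ ≤ 1 := by
    have := Finset.single_le_sum (f := d) (fun _ _ => Nat.zero_le _) hc₁
    omega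
  refine ⟨c₁, hc₁ne, le_antisymm hle1 (hpos c₁), fun c => ?_⟩
  by_contra hc
  push Not at hc
  have hmem : c ∈ (Finset.univ.erase c₀).erase c₁ :=
    Finset.mem_erase.2 ⟨hc.2, Finset.mem_erase.2 ⟨hc.1, Finset.mem_univ c⟩⟩
  have hle : d c ≤ ∑ x ∈ (Finset.univ.erase c₀).erase c₁, d x :=
    Finset.single_le_sum (f := d) (fun _ _ => Nat.zero_le _) hmem
  have h1 := hpos c
  have h1' := hpos c₁
  omega

/-- Three pairwise distinct indices carrying at least `2` each cannot occur when the total is `4`. [folklore] -/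
private theorem not_three_of_sum_eq_four (hsum : ∑ c, d c = 4) {i j k : C} (hij : i ≠ j) (hjk : j ≠ k) (hik : i ≠ k)
    (hi : 2 ≤ d i) (hj : 2 ≤ d j) (hk : 2 ≤ d k) : False := by
  have hsub : ({i, j, k} : Finset C) ⊆ Finset.univ := Finset.subset_univ _
  have hle := Finset.sum_le_sum_of_subset_of_nonneg hsub (f := d) (fun _ _ _ => Nat.zero_le _)
  rw [Finset.sum_insert (by simp [hij, hik]), Finset.sum_pair hjk, hsum] at hle
  omega

end Arith

/-! ## §2 The shape of a degenerate separating family of total dimension `4` -/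

section Family

variable {C : Type} [Fintype C] [DecidableEq C] {K' : C → Type} [∀ c, Field (K' c)] [∀ c, NumberField (K' c)]
  [∀ c, IsCMField (K' c)] {Φ' : ∀ c, CMType (K' c)} {A' : C → AbelianVariety ℂ}
  {ι' : ∀ c, 𝓞 (K' c) →+* End (A' c)} {θ' : ∀ c, K' c →+* Module.End ℂ (complexBetti (A' c).X 1)}

omit [DecidableEq C] [Fintype C] [∀ c, IsCMField (K' c)] in
/-- A realisation of a CM type has positive dimension (`2 dim A = [K:ℚ] > 0`). [cite: Shimura1998, §5.2] -/
theorem one_le_dim_of_isCMTypeRealisation (hA : ∀ c, IsCMTypeRealisation (Φ' c) (A' c) (ι' c) (θ' c)) (c : C) :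
    1 ≤ (A' c).dim := by
  have h := finrank_eq_two_mul_dim_of_isCMTypeRealisation (hA c)
  have hpos : 0 < finrank ℚ (K' c) := Module.finrank_pos
  omega

/-- **A curve slot and one simple slot of degree `≤ 6`: nondegenerate iff the quadratic field does not embed**
(Moonen–Zarhin (0.2) for `E × T` in the CM case; the two-slot reading of b16's
`isNondegenerateFamily_iff_forall_isEmpty_of_finrank_le_six`, re-derived here so that this file does not wait for the
olean of `CorCM/SimpleCMPairsDimLeThreeHodge`, whose `isNondegenerateFamily_iff_isEmpty_of_quadratic_slot` is the same
statement). [cite: MoonenZarhin1999LowDim, Thm. (0.2) (a) and (4)] [cite: Ribet1980, §3 (3.7)] -/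
theorem isNondegenerateFamily_iff_isEmpty_of_quadratic_slot' [Nonempty C] {c₁ c₀ : C} (h10 : c₁ ≠ c₀)
    (hC : ∀ c, c = c₁ ∨ c = c₀) (h2 : finrank ℚ (K' c₁) = 2) (h6 : finrank ℚ (K' c₀) ≤ 6)
    (hA : ∀ c, IsCMTypeRealisation (Φ' c) (A' c) (ι' c) (θ' c)) (hs : ∀ c, (A' c).IsSimple)
    (hniso : ∀ c c', c ≠ c' → ¬ IsIsogenous (A' c) (A' c')) :
    CMAlgebra.IsNondegenerateFamily Φ' ↔ IsEmpty (K' c₁ →+* K' c₀) := by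
  obtain ⟨φ₀⟩ : Nonempty (K' c₀ →+* ℂ) := inferInstance
  have h2' : ∀ j, j ≠ c₀ → finrank ℚ (K' j) = 2 := fun j hj => by
    rcases hC j with rfl | rfl
    · exact h2
    · exact absurd rfl hj
  have hsep := isSeparatingFamily_subtype
    (CMAlgebra.isSeparatingFamily_of_isSimple_of_pairwise_not_isIsogenous hA hs hniso) (fun j => j ≠ c₀)
  rw [isNondegenerateFamily_iff_forall_isEmpty_of_finrank_le_six c₀ Φ' h2' hsep h6 φ₀
    ((Literature.AlgebraicGeometry.ComplexMultiplication.isSimple_iff_isPrimitive (hA c₀) φ₀).1 (hs c₀))]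
  constructor
  · exact fun h => h c₁ h10
  · intro h a ha
    rcases hC a with rfl | rfl
    · exact h
    · exact absurd rfl ha

/-- **The shape of a DEGENERATE separating family of simple CM realisations of total dimension `4`.**  If the
`A'_c ⊨ (K_c; Φ_c)` are SIMPLE and PAIRWISE NON-ISOGENOUS with `Σ_c dim A'_c = 4` and the family `(Φ_c)_c` is NOT
nondegenerate (`Hg(∏_c A'_c) ⊊ ∏_c Hg(A'_c)` or some `Hg(A'_c)` of rank `< dim A'_c`), then EITHER there is a single index,
a simple CM FOURFOLD, OR there are exactly two indices, a simple CM THREEFOLD `A'_{c₀}` and a CM ELLIPTIC CURVE `A'_{c₁}`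
whose imaginary quadratic field embeds in `K_{c₀}`.  (Patterns `{2,2}`, `{2,1,1}`, `{1,1,1,1}`: no three of the fields
share a Galois closure — a quadratic closure is shared with no other slot of a separating family, and three quartic slots
would have total dimension `6` — so p2's closure criterion makes the family nondegenerate; pattern `{3,1}`: b16's
Moonen–Zarhin criterion.) [cite: MoonenZarhin1999LowDim, Thm. (0.1), Thm. (0.2) and Cor. (3.9)]
[cite: Gordon1999HodgeAVSurvey, 7.5 and 9.4] -/
theorem shape_of_not_isNondegenerateFamily_of_sum_dim_eq_four
    (hA : ∀ c, IsCMTypeRealisation (Φ' c) (A' c) (ι' c) (θ' c)) (hs : ∀ c, (A' c).IsSimple)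
    (hniso : ∀ c c', c ≠ c' → ¬ IsIsogenous (A' c) (A' c')) (hsum : ∑ c, (A' c).dim = 4)
    (hdeg : ¬ CMAlgebra.IsNondegenerateFamily Φ') :
    (∃ c₀, (A' c₀).dim = 4 ∧ ∀ c, c = c₀) ∨
      ∃ c₀ c₁, c₁ ≠ c₀ ∧ (A' c₀).dim = 3 ∧ (A' c₁).dim = 1 ∧ (∀ c, c = c₀ ∨ c = c₁) ∧
        finrank ℚ (K' c₀) = 6 ∧ finrank ℚ (K' c₁) = 2 ∧ Nonempty (K' c₁ →+* K' c₀) := by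
  have hpos := one_le_dim_of_isCMTypeRealisation hA
  have hdeg2 : ∀ c, finrank ℚ (K' c) = 2 * (A' c).dim := fun c => finrank_eq_two_mul_dim_of_isCMTypeRealisation (hA c)
  by_cases hbig : ∃ c₀, 3 ≤ (A' c₀).dim
  · obtain ⟨c₀, hc₀⟩ := hbig
    have hle4 : (A' c₀).dim ≤ 4 := by
      have := Finset.single_le_sum (f := fun c => (A' c).dim) (fun _ _ => Nat.zero_le _) (Finset.mem_univ c₀)
      simpa only [hsum] using this
    rcases (show (A' c₀).dim = 3 ∨ (A' c₀).dim = 4 by omega) with h3 | h4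
    · -- pattern `{3, 1}`: Moonen–Zarhin (0.2)
      right
      obtain ⟨c₁, hc₁, hd₁, hall⟩ := exists_eq_one_of_sum_eq_four_of_eq_three hpos hsum h3
      haveI : Nonempty C := ⟨c₀⟩
      have h2 : finrank ℚ (K' c₁) = 2 := by rw [hdeg2, hd₁]
      have h6 : finrank ℚ (K' c₀) = 6 := by rw [hdeg2, h3]
      have hiff := isNondegenerateFamily_iff_isEmpty_of_quadratic_slot' hc₁ (fun j => (hall j).symm) h2 h6.le hA hs hniso
      refine ⟨c₀, c₁, hc₁, h3, hd₁, hall, h6, h2, ?_⟩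
      by_contra hne
      rw [not_nonempty_iff] at hne
      exact hdeg (hiff.2 hne)
    · -- pattern `{4}`
      exact Or.inl ⟨c₀, h4, forall_eq_of_sum_eq_four_of_eq_four hpos hsum h4⟩
  · -- patterns with all dimensions `≤ 2`: nondegenerate by the closure criterion — contradiction
    exfalso
    push Not at hbig
    have hdim : ∀ c, finrank ℚ (K' c) = 2 ∨ finrank ℚ (K' c) = 4 := fun c => by
      have h1 := hpos c
      have h2 := hbig c
      have h := hdeg2 c
      omega
    haveI : Nonempty C := by
      by_contra hC
      rw [not_nonempty_iff] at hC
      rw [Finset.univ_eq_empty, Finset.sum_empty] at hsum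
      exact absurd hsum (by norm_num)
    have hsep : CMAlgebra.IsSeparatingFamily Φ' :=
      CMAlgebra.isSeparatingFamily_of_isSimple_of_pairwise_not_isIsogenous hA hs hniso
    refine hdeg (CMCurvesAndSurfaces.isNondegenerateFamily_curves_simpleSurfaces_of_closures hdim hA hs hniso ?_)
    intro i j k hij hjk hik hLij hLjk
    -- none of the three slots is a curve (a curve slot shares its closure with no other slot) …
    have hqi : finrank ℚ (K' i) ≠ 2 := fun h2 =>
      CMCurvesAndSurfaces.normalClosure_ne_of_finrank_eq_two hdim hsep hij h2 hLij
    have hqj : finrank ℚ (K' j) ≠ 2 := fun h2 =>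
      CMCurvesAndSurfaces.normalClosure_ne_of_finrank_eq_two hdim hsep hjk h2 hLjk
    have hqk : finrank ℚ (K' k) ≠ 2 := fun h2 =>
      CMCurvesAndSurfaces.normalClosure_ne_of_finrank_eq_two hdim hsep (Ne.symm hjk) h2 hLjk.symm
    -- … so all three are surfaces, of total dimension `6 > 4`
    refine not_three_of_sum_eq_four hsum hij hjk hik ?_ ?_ ?_
    · have := hdim i; have := hdeg2 i; omega
    · have := hdim j; have := hdeg2 j; omega
    · have := hdim k; have := hdeg2 k; omega

end Family

/-! ## §3 On the variety: `dim MT(H¹(X)) = 4` for `X` of CM type -/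

section Variety

variable [HodgeTensorFacts.{0, 0}] {X : AbelianVariety ℂ} {n : ℕ} (hX : IsSmoothProjective n X.X)

/-- **At `dim MT(H¹(X)) = 4` the reduced dimension is `3` or `4`**, and it is `3` iff every power `X^{N+1}` is
divisor-generated: for `X` of CM type with `dim MT(H¹(X)) = 4` there is a regrouping `X ∼ ⨁_j A'_{cls j}` into copies of
simple, pairwise non-isogenous CM realisations with `Σ_c dim A'_c ∈ {3, 4}` (Ribet `4 · rdim ≤ 2⁴`, Kubota
`4 ≤ rdim + 1`) and `(Σ_c dim A'_c = 3) ↔ ∀ N, B•(X^{N+1}) = D•(X^{N+1})` (Hazama–Murty).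
[cite: Gordon1999HodgeAVSurvey, 7.4, 7.5 and 7.7] [cite: Dodson1987, Thm. 1.0 (iii)] -/
theorem sum_dim_eq_three_or_four_of_mtRank_hodge_one_eq_four (h0 : 0 < X.dim) (hcm : IsOfCMType X)
    (h4 : haveI := BettiUniverse.finite hX 1
      (BettiUniverse.hodge exists_isReal_hodgeModel_holds hX 1).mtRank = 4) :
    ∃ (C : Type) (_ : Fintype C) (K' : C → Type) (_ : ∀ c, Field (K' c)) (_ : ∀ c, NumberField (K' c))
      (_ : ∀ c, IsCMField (K' c)) (Φ' : ∀ c, CMType (K' c)) (A' : C → AbelianVariety ℂ)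
      (ι' : ∀ c, 𝓞 (K' c) →+* End (A' c)) (θ' : ∀ c, K' c →+* Module.End ℂ (complexBetti (A' c).X 1))
      (m : ℕ) (cls : Fin (m + 1) → C) (f : X ⟶ ⨁ fun i => A' (cls i)),
      (∀ c, IsCMTypeRealisation (Φ' c) (A' c) (ι' c) (θ' c)) ∧ (∀ c, (A' c).IsSimple) ∧
      (∀ c c', c ≠ c' → ¬ IsIsogenous (A' c) (A' c')) ∧ Function.Surjective cls ∧ IsIsogeny f ∧
      (∑ c, (A' c).dim = 3 ∨ ∑ c, (A' c).dim = 4) ∧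
      ((∑ c, (A' c).dim = 3) ↔ ∀ N : ℕ, IsDivisorGenerated (X.powSucc N)) ∧
      (CMAlgebra.IsNondegenerateFamily Φ' ↔ ∀ N : ℕ, IsDivisorGenerated (X.powSucc N)) := by
  obtain ⟨r, -, hle, hiff, C, _, K', _, _, _, Φ', A', ι', θ', m, cls, f, hA, hs, hniso, hcls, hf, hrsum, -⟩ :=
    exists_rdim_of_isOfCMType hX h0 hcm
  have hrib := four_mul_sum_dim_le_two_pow_mtRank_hodge_one hA hs hniso hcls hX ⟨f, hf⟩
  have hnd := isNondegenerateFamily_iff_mtRank_hodge_one_eq hA hcls hX ⟨f, hf⟩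
  rw [h4] at hle hrib hiff hnd
  rw [← hrsum] at hrib
  refine ⟨C, inferInstance, K', inferInstance, inferInstance, inferInstance, Φ', A', ι', θ', m, cls, f, hA, hs, hniso,
    hcls, hf, ?_, ?_, ?_⟩
  · omega
  · rw [hiff, ← hrsum]; omega
  · rw [hnd, hiff, hrsum]

/-- **The two degenerate shapes at Mumford–Tate rank `4`.**  Let `X` be a complex abelian variety of CM type with
`dim MT(H¹(X)) = 4` some power of which is NOT divisor-generated (equivalently: `rdim X = 4`; equivalently: some power
carries an exceptional Hodge class).  Then EITHER
* `X ∼ ⨁_{Fin (m+1)} A` for a SIMPLE complex abelian FOURFOLD `A` of CM type with `dim MT(H¹(A)) = 4` and `B(A) ≠ D(A)`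
  (Gordon 5.13 (ii): `A` is of Weil type for an imaginary quadratic subfield of its octic CM field), OR
* `X ∼ ⨁_j ![E, T] (κ j)` with `κ : Fin (m+1) → Fin 2` onto, `T ⊨ (K; Φ)` a SIMPLE abelian threefold with CM by a sextic
  CM field `K`, `E ⊨ (k; Ψ)` an elliptic curve with CM by an imaginary quadratic field `k`, and `i : k →+* K`
  (Moonen–Zarhin 1999 Thm. (0.2) (a): `X ∼ E^c × T^a` with `k ↪ End⁰(T) = K`).
[cite: MoonenZarhin1999LowDim, Thm. (0.1) and Thm. (0.2) (a)] [cite: Gordon1999HodgeAVSurvey, 5.13 (ii), 7.5 and 9.4] -/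
theorem shape_of_mtRank_hodge_one_eq_four_of_not_forall_isDivisorGenerated (h0 : 0 < X.dim) (hcm : IsOfCMType X)
    (h4 : haveI := BettiUniverse.finite hX 1
      (BettiUniverse.hodge exists_isReal_hodgeModel_holds hX 1).mtRank = 4)
    (hnot : ¬ ∀ N : ℕ, IsDivisorGenerated (X.powSucc N)) :
    (∃ (A : AbelianVariety ℂ) (m : ℕ), A.IsSimple ∧ A.dim = 4 ∧ IsOfCMType A ∧ ¬ IsDivisorGenerated A ∧
        @HodgeStructure.mtRank _ _ _ ‹HodgeTensorFacts.{0, 0}›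
            (BettiUniverse.finite (AbelianVariety.isSmoothProjective_holds (A := A)) 1) _
            (BettiUniverse.hodge exists_isReal_hodgeModel_holds (AbelianVariety.isSmoothProjective_holds (A := A)) 1) = 4 ∧
        IsIsogenous X (⨁ fun _ : Fin (m + 1) => A)) ∨
      ∃ (K k : Type) (_ : Field K) (_ : NumberField K) (_ : IsCMField K) (_ : Field k) (_ : NumberField k)
        (_ : IsCMField k) (Φ : CMType K) (Ψ : CMType k) (T E : AbelianVariety ℂ) (ιT : 𝓞 K →+* End T)
        (θT : K →+* Module.End ℂ (complexBetti T.X 1)) (ιE : 𝓞 k →+* End E)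
        (θE : k →+* Module.End ℂ (complexBetti E.X 1)) (_ : k →+* K) (m : ℕ) (κ : Fin (m + 1) → Fin 2),
        finrank ℚ K = 6 ∧ finrank ℚ k = 2 ∧ IsCMTypeRealisation Φ T ιT θT ∧ T.IsSimple ∧ T.dim = 3 ∧
          IsCMTypeRealisation Ψ E ιE θE ∧ E.dim = 1 ∧ ¬ IsIsogenous E T ∧ Function.Surjective κ ∧
          IsIsogenous X (⨁ fun j => (![E, T] : Fin 2 → AbelianVariety ℂ) (κ j)) := by
  classical
  obtain ⟨C, _, K', _, _, _, Φ', A', ι', θ', m, cls, f, hA, hs, hniso, hcls, hf, h34, h3iff, hndiff⟩ :=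
    sum_dim_eq_three_or_four_of_mtRank_hodge_one_eq_four hX h0 hcm h4
  have hsum : ∑ c, (A' c).dim = 4 := by
    rcases h34 with h3 | h4'
    · exact absurd (h3iff.1 h3) hnot
    · exact h4'
  have hdeg : ¬ CMAlgebra.IsNondegenerateFamily Φ' := fun h => hnot (hndiff.1 h)
  rcases shape_of_not_isNondegenerateFamily_of_sum_dim_eq_four hA hs hniso hsum hdeg with
    ⟨c₀, hd4, hall⟩ | ⟨c₀, c₁, hc₁, hd3, hd1, hall, h6, h2, ⟨i⟩⟩
  · -- one simple CM fourfold
    left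
    have hfun : (fun j => A' (cls j)) = fun _ : Fin (m + 1) => A' c₀ := funext fun j => congrArg A' (hall (cls j))
    have hXB : IsIsogenous X (⨁ fun _ : Fin (m + 1) => A' c₀) := by rw [← hfun]; exact ⟨f, hf⟩
    have hcmA : IsOfCMType (A' c₀) := isOfCMType_of_isCMTypeRealisation (hA c₀)
    -- `dim MT(H¹(A)) = cmFamilyRank Φ' = dim MT(H¹(X)) = 4`
    have hcls₀ : Function.Surjective (fun _ : Fin 1 => c₀) := fun c => ⟨0, (hall c).symm⟩
    have hAB : IsIsogenous (A' c₀) (⨁ fun j : Fin 1 => A' ((fun _ : Fin 1 => c₀) j)) :=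
      isIsogenous_powSucc_biproduct (A' c₀) 0
    have hmtA := mtRank_hodge_one_eq_cmFamilyRank_of_isIsogenous_biproduct hA hcls₀
      (AbelianVariety.isSmoothProjective_holds (A := A' c₀)) hAB
    have hmtX := mtRank_hodge_one_eq_cmFamilyRank_of_isIsogenous_biproduct hA hcls hX ⟨f, hf⟩
    have hmtA4 : haveI := BettiUniverse.finite (AbelianVariety.isSmoothProjective_holds (A := A' c₀)) 1
        (BettiUniverse.hodge exists_isReal_hodgeModel_holds
          (AbelianVariety.isSmoothProjective_holds (A := A' c₀)) 1).mtRank = 4 := by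
      rw [hmtA, ← hmtX, h4]
    refine ⟨A' c₀, m, hs c₀, hd4, hcmA, ?_, hmtA4, hXB⟩
    rw [isDivisorGenerated_iff_mtRank_eq_five_of_dim_four (AbelianVariety.isSmoothProjective_holds (A := A' c₀))
      (hs c₀) hd4 hcmA, hmtA4]
    norm_num
  · -- a simple CM threefold and a CM elliptic curve with `k ↪ K`
    right
    let κ : Fin (m + 1) → Fin 2 := fun j => if cls j = c₁ then 0 else 1
    have hfun : (fun j => A' (cls j)) = fun j => (![A' c₁, A' c₀] : Fin 2 → AbelianVariety ℂ) (κ j) := by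
      funext j
      rcases hall (cls j) with h | h
      · have hne : cls j ≠ c₁ := by rw [h]; exact hc₁.symm
        simp only [κ, if_neg hne, h]; rfl
      · simp only [κ, if_pos h, h]; rfl
    have hXB : IsIsogenous X (⨁ fun j => (![A' c₁, A' c₀] : Fin 2 → AbelianVariety ℂ) (κ j)) := by
      rw [← hfun]; exact ⟨f, hf⟩
    have hκ : Function.Surjective κ := by
      intro l
      fin_cases l
      · obtain ⟨j, hj⟩ := hcls c₁
        exact ⟨j, by simp [κ, hj]⟩
      · obtain ⟨j, hj⟩ := hcls c₀
        have hne : cls j ≠ c₁ := by rw [hj]; exact hc₁.symm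
        exact ⟨j, by simp [κ, hne]⟩
    exact ⟨K' c₀, K' c₁, inferInstance, inferInstance, inferInstance, inferInstance, inferInstance, inferInstance, Φ' c₀,
      Φ' c₁, A' c₀, A' c₁, ι' c₀, θ' c₀, ι' c₁, θ' c₁, i, m, κ, h6, h2, hA c₀, hs c₀, hd3, hA c₁, hd1,
      hniso c₁ c₀ hc₁, hκ, hXB⟩

end Variety


end Summit.HodgeConjecture.CorCM

end
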